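import Summits.Ventures.QEC.Census.BB.BB90Rank
import Summits.Ventures.QEC.Theses.BB90DistanceCertificate
import HarnessLib

/-!
# Route BB90DistanceCertificate, item `EightLogicalQubits90` (stmt-Ventures-19783): `BB.bb90.k = 8`

Closer of the support item `EightLogicalQubits90 : (BB.bb90).k = 8` of route
`Summits/Ventures/QEC/Theses/BB90DistanceCertificate.lean` (LADDER-QEC rung Q2, the `[[90,8,10]]` code of
Bravyi–Cross–Gambetta–Maslov–Rall–Yoder 2024): the dimension of the typed bivariate-bicycle code `QC(x⁹+y+y², 1+x²+x⁷)` on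
`ℤ₁₅ × ℤ₃` is `k = n − rank H^X − rank H^Z = 90 − 41 − 41 = 8`, the two ranks being established by kernel-checked RANK
CERTIFICATES (`Summits/Ventures/QEC/Census/BB/BB90Rank.lean`, p467713: CERT-FORMAT v1 §3 `k_cert`, checker `RankCert.check` by
`decide +kernel`, soundness `rank_rowMatrix_of_check` (L0); the numeral rows are identified with `BB.bb90.HXFlat/HZFlat` entry
by entry). This file only re-states `Census.bb90_k` at the route declaration's type; it is the one file of the item allowed
to import the Theses module (cell build rule). Tier KERNEL: axioms ⊆ {propext, Classical.choice, Quot.sound}.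
-/

namespace Summit.Ventures.QEC.Theorems

/-- **`k(BB90) = 8`** — route item `EightLogicalQubits90` (stmt-Ventures-19783) of route BB90DistanceCertificate,
discharged by the kernel-checked rank certificates of `Census/BB/BB90Rank.lean` (`Census.bb90_k`:
`rank₂ H^X = rank₂ H^Z = 41`, `k = 90 − 41 − 41`).
[cite: BravyiEtAl2024, Extended Data Table 1 / arXiv Table 3 row [[90,8,10]] (Nature Table 1, p0003) and §4 Lemma 1
(arXiv:2308.07915 chunk p0009 L66–83: k = n − rk H^X − rk H^Z)] -/
theorem EightLogicalQubits90_proof :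
    Summit.Ventures.QEC.Theses.BB90DistanceCertificate.EightLogicalQubits90 := by
  unfold Summit.Ventures.QEC.Theses.BB90DistanceCertificate.EightLogicalQubits90
  exact Summit.Ventures.QEC.Census.bb90_k

end Summit.Ventures.QEC.Theorems
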